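import Literature.Geometry.Lorentzian.DataFamilyTangentKernelChart
import Literature.Geometry.Lorentzian.DataFamilyComap
import HarnessLib

/-!
# Tangents of smooth families of data with stationary constraints lie in `ker DΦ` — on a `3`-manifold

Topic `Literature/Geometry/Lorentzian`. Everything here is PROVED; no definition, no statement of
`Prop` type is introduced.

Third part of `DataFamilyTangentKernel.lean` (data on `E3`) / `DataFamilyTangentKernelChart.lean`
(data on chart domains `U : Opens E3`): the witness families of the named fact
`ChruscielDelay_localConstraintDeformation` (`LocalConstraintDeformation.lean`) live on a general
`3`-manifold `X`; reading them through a smooth map with injective differentials `Φ : U → X` from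
a chart domain (e.g. an inverse chart; `InitialDataSet.comap`, `IsSmoothDataFamily.comap` of
`DataFamilyComap.lean`) produces smooth families on `U` whose constraint functions are those of the
original family at `Φ u` (naturality, `hamiltonianConstraintFn_comap`,
`momentumConstraintFn_comap_apply`; Bartnik–Isenberg 2004, §2), so that:

* `InitialDataSet.linConstraint_comapTangent_eq_zero` — **if the constraint functions are
  stationary at `s = 0` at `Φ y` along a smooth family `F` on `X`, the variations at `s = 0` of the
  coordinate readings of `s ↦ Φ^*(F(s e₀))` lie in the kernel of the coordinate linearised
  constraint map at `y`** (`MetricCoord.linHamFn`, `linMomFn`; Chruściel–Delay 2003, §2);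
* `InitialDataSet.deriv_comap_h_inner_line`, `deriv_comap_k_line` — **the tangent of the
  pulled-back family is the pullback of the tangent**, `d/ds|₀ (Φ^*h_{s e₀})_u =
  (dΦ_u)ᵀ (d/ds|₀ h_{s e₀}(Φ u)) dΦ_u` (the fibrewise curves of a smooth family are differentiable,
  `differentiableAt_bilin_line`; `B ↦ Tᵀ B T` is continuous linear, `deriv_precomp_comp_comp`).

## References

* P. T. Chruściel, E. Delay, Mém. Soc. Math. Fr. 94 (2003), §2. [ChruscielDelay2003]
* R. Bartnik, J. Isenberg, *The constraint equations* (2004), §2. [BartnikIsenberg2004]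
-/

noncomputable section

set_option maxSynthPendingDepth 3

open Bundle Set Function Filter TopologicalSpace Manifold Module
open scoped Manifold ContDiff Topology

namespace Literature.Geometry.Lorentzian

namespace InitialDataSet

variable {U : Opens E3}

/-! ### Data on a `3`-manifold, read through an equidimensional immersion from a chart domain -/

section Manifold

variable {X : Type*} [TopologicalSpace X] [ChartedSpace E3 X] [IsManifold (𝓡 3) ∞ X]

/-- **The derivative of a pulled-back curve of bilinear forms**: for a fixed `T : E3 →L E3` and
a curve `f` of forms differentiable at `t`, `d/ds [Tᵀ f(s) T] = Tᵀ f'(t) T` (`B ↦ Tᵀ B T` is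
continuous linear). [folklore] -/
theorem deriv_precomp_comp_comp {f : ℝ → E3 →L[ℝ] E3 →L[ℝ] ℝ} (T : E3 →L[ℝ] E3) {t : ℝ}
    (hd : DifferentiableAt ℝ f t) :
    deriv (fun s ↦ (ContinuousLinearMap.precomp ℝ T).comp ((f s).comp T)) t =
      (ContinuousLinearMap.precomp ℝ T).comp ((deriv f t).comp T) := by
  set Λ : (E3 →L[ℝ] E3 →L[ℝ] ℝ) →L[ℝ] (E3 →L[ℝ] E3 →L[ℝ] ℝ) :=
    (ContinuousLinearMap.compL ℝ E3 (E3 →L[ℝ] ℝ) (E3 →L[ℝ] ℝ) (ContinuousLinearMap.precomp ℝ T)).comp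
      ((ContinuousLinearMap.compL ℝ E3 E3 (E3 →L[ℝ] ℝ)).flip T) with hΛdef
  have hΛ : ∀ B : E3 →L[ℝ] E3 →L[ℝ] ℝ, Λ B = (ContinuousLinearMap.precomp ℝ T).comp (B.comp T) :=
    fun B ↦ rfl
  have h : HasDerivAt (fun s ↦ Λ (f s)) (Λ (deriv f t)) t :=
    Λ.hasFDerivAt.comp_hasDerivAt t hd.hasDerivAt
  exact h.deriv

/-- **A jointly smooth family of data is differentiable in the parameter, fibre by fibre**: for
`F` a smooth one-parameter family on `X` and `x : X`, the curve `s ↦ h_{s e₀}(x)` of forms on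
`T_x X = E3` is differentiable (read the section at the fixed base point `x` through the
trivialisation at `x`, `contMDiffAt_bilin_iff`, and undo the — invertible — trivialisation).
[folklore] -/
theorem differentiableAt_bilin_line
    {σ : EuclideanSpace ℝ (Fin 1) → Π x : X, TangentSpace (𝓡 3) x →L[ℝ] TangentSpace (𝓡 3) x →L[ℝ] ℝ}
    (hσ : ContMDiff (𝓘(ℝ, EuclideanSpace ℝ (Fin 1)).prod (𝓡 3)) ((𝓡 3).prod 𝓘(ℝ, E3 →L[ℝ] E3 →L[ℝ] ℝ)) ∞
      (fun p : EuclideanSpace ℝ (Fin 1) × X ↦ TotalSpace.mk' (E3 →L[ℝ] E3 →L[ℝ] ℝ)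
        (E := fun x : X ↦ TangentSpace (𝓡 3) x →L[ℝ] TangentSpace (𝓡 3) x →L[ℝ] ℝ) p.2 (σ p.1 p.2)))
    (x : X) (t : ℝ) :
    DifferentiableAt ℝ (fun s : ℝ ↦ (show E3 →L[ℝ] E3 →L[ℝ] ℝ from σ (EuclideanSpace.single 0 s) x)) t := by
  -- the section along the axis at the fixed base point `x`
  have h0 : ContMDiffAt 𝓘(ℝ, ℝ) ((𝓡 3).prod 𝓘(ℝ, E3 →L[ℝ] E3 →L[ℝ] ℝ)) ∞
      (fun s : ℝ ↦ TotalSpace.mk' (E3 →L[ℝ] E3 →L[ℝ] ℝ)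
        (E := fun x : X ↦ TangentSpace (𝓡 3) x →L[ℝ] TangentSpace (𝓡 3) x →L[ℝ] ℝ) x
        (σ (EuclideanSpace.single 0 s) x)) t :=
    (hσ _).comp t (contDiff_single_zero.contMDiff.contMDiffAt.prodMk contMDiffAt_const)
  set τ := trivializationAt E3 (TangentSpace (𝓡 3) : X → Type _) x with hτ
  have hx : x ∈ τ.baseSet := FiberBundle.mem_baseSet_trivializationAt' x
  have h1 := ((contMDiffAt_bilin_iff (IX := 𝓘(ℝ, ℝ)) (IB := 𝓡 3)
    (V := (TangentSpace (𝓡 3) : X → Type _)) (b := fun _ : ℝ ↦ x)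
    (s := fun s : ℝ ↦ σ (EuclideanSpace.single 0 s) x) (x₀ := t)).1 h0).2
  -- `h1`: `s ↦ Sᵀ (σ_s x) S` is smooth, `S = τ.symmL x` invertible with inverse `S'`
  have h2 : ContDiffAt ℝ ∞ (fun s : ℝ ↦ (ContinuousLinearMap.precomp ℝ (τ.symmL ℝ x)).comp
      ((σ (EuclideanSpace.single 0 s) x).comp (τ.symmL ℝ x))) t := contMDiffAt_iff_contDiffAt.1 h1
  set S : E3 →L[ℝ] E3 := (show E3 →L[ℝ] E3 from τ.symmL ℝ x) with hS
  set S' : E3 →L[ℝ] E3 :=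
    (show E3 →L[ℝ] E3 from (τ.continuousLinearEquivAt ℝ x hx).toContinuousLinearMap) with hS'
  have hSS' : ∀ v : E3, S (S' v) = v := by
    intro v
    show (τ.symmL ℝ x) ((τ.continuousLinearEquivAt ℝ x hx) v) = v
    rw [← Trivialization.symm_continuousLinearEquivAt_eq' τ hx]
    exact (τ.continuousLinearEquivAt ℝ x hx).symm_apply_apply v
  set Λ : (E3 →L[ℝ] E3 →L[ℝ] ℝ) →L[ℝ] (E3 →L[ℝ] E3 →L[ℝ] ℝ) :=
    (ContinuousLinearMap.compL ℝ E3 (E3 →L[ℝ] ℝ) (E3 →L[ℝ] ℝ) (ContinuousLinearMap.precomp ℝ S')).comp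
      ((ContinuousLinearMap.compL ℝ E3 E3 (E3 →L[ℝ] ℝ)).flip S') with hΛdef
  have hΛ : ∀ B : E3 →L[ℝ] E3 →L[ℝ] ℝ, Λ B = (ContinuousLinearMap.precomp ℝ S').comp (B.comp S') :=
    fun B ↦ rfl
  have h3 : ContDiffAt ℝ ∞ (fun s : ℝ ↦ Λ ((ContinuousLinearMap.precomp ℝ S).comp
      ((show E3 →L[ℝ] E3 →L[ℝ] ℝ from σ (EuclideanSpace.single 0 s) x).comp S))) t :=
    Λ.contDiff.contDiffAt.comp t h2
  have heq : (fun s : ℝ ↦ Λ ((ContinuousLinearMap.precomp ℝ S).comp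
      ((show E3 →L[ℝ] E3 →L[ℝ] ℝ from σ (EuclideanSpace.single 0 s) x).comp S))) =
      fun s : ℝ ↦ (show E3 →L[ℝ] E3 →L[ℝ] ℝ from σ (EuclideanSpace.single 0 s) x) := by
    funext s
    rw [hΛ]
    ext v w
    simp only [ContinuousLinearMap.comp_apply, ContinuousLinearMap.precomp_apply, hSS']
  rw [heq] at h3
  exact h3.differentiableAt (by simp)

/-- **The tangent of the pulled-back family is the pullback of the tangent** (metric part): for
`u ∈ U`, `d/ds|₀ (Φ^* h_{s e₀})_u = (dΦ_u)ᵀ (d/ds|₀ h_{s e₀}(Φ u)) (dΦ_u)`. [folklore] -/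
theorem deriv_comap_h_inner_line (F : EuclideanSpace ℝ (Fin 1) → InitialDataSet (𝓡 3) X)
    (hF : IsSmoothDataFamily 1 F) {Φ : U → X} (hΦ : ContMDiff 𝓘(ℝ, E3) (𝓡 3) (∞ + 1) Φ)
    (hΦ' : ∀ u, Function.Injective (mfderiv 𝓘(ℝ, E3) (𝓡 3) Φ u)) (u : U) :
    deriv (fun s : ℝ ↦ (show E3 →L[ℝ] E3 →L[ℝ] ℝ from
        ((F (EuclideanSpace.single 0 s)).comap Φ hΦ hΦ').h.inner u)) 0 =
      (ContinuousLinearMap.precomp ℝ (mfderiv 𝓘(ℝ, E3) (𝓡 3) Φ u : E3 →L[ℝ] E3)).comp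
        ((deriv (fun s : ℝ ↦ (show E3 →L[ℝ] E3 →L[ℝ] ℝ from
          (F (EuclideanSpace.single 0 s)).h.inner (Φ u))) 0).comp
          (mfderiv 𝓘(ℝ, E3) (𝓡 3) Φ u : E3 →L[ℝ] E3)) :=
  deriv_precomp_comp_comp (f := fun s : ℝ ↦ (show E3 →L[ℝ] E3 →L[ℝ] ℝ from
    (F (EuclideanSpace.single 0 s)).h.inner (Φ u))) (mfderiv 𝓘(ℝ, E3) (𝓡 3) Φ u)
    (differentiableAt_bilin_line (σ := fun c x ↦ (F c).h.inner x) hF.1 (Φ u) 0)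

/-- **The tangent of the pulled-back family is the pullback of the tangent** (`k` part).
[folklore] -/
theorem deriv_comap_k_line (F : EuclideanSpace ℝ (Fin 1) → InitialDataSet (𝓡 3) X)
    (hF : IsSmoothDataFamily 1 F) {Φ : U → X} (hΦ : ContMDiff 𝓘(ℝ, E3) (𝓡 3) (∞ + 1) Φ)
    (hΦ' : ∀ u, Function.Injective (mfderiv 𝓘(ℝ, E3) (𝓡 3) Φ u)) (u : U) :
    deriv (fun s : ℝ ↦ (show E3 →L[ℝ] E3 →L[ℝ] ℝ from
        ((F (EuclideanSpace.single 0 s)).comap Φ hΦ hΦ').k u)) 0 =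
      (ContinuousLinearMap.precomp ℝ (mfderiv 𝓘(ℝ, E3) (𝓡 3) Φ u : E3 →L[ℝ] E3)).comp
        ((deriv (fun s : ℝ ↦ (show E3 →L[ℝ] E3 →L[ℝ] ℝ from
          (F (EuclideanSpace.single 0 s)).k (Φ u))) 0).comp
          (mfderiv 𝓘(ℝ, E3) (𝓡 3) Φ u : E3 →L[ℝ] E3)) :=
  deriv_precomp_comp_comp (f := fun s : ℝ ↦ (show E3 →L[ℝ] E3 →L[ℝ] ℝ from
    (F (EuclideanSpace.single 0 s)).k (Φ u))) (mfderiv 𝓘(ℝ, E3) (𝓡 3) Φ u)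
    (differentiableAt_bilin_line (σ := fun c x ↦ (F c).k x) hF.2 (Φ u) 0)

/-- **The witness hypothesis of the fact, read in a chart.** Let `F` be a jointly smooth
one-parameter family of data on a `3`-manifold `X` and `Φ : U → X` a smooth map with injective
differentials from a chart domain `U : Opens E3` (e.g. an inverse chart). If along `F` the
Hamiltonian and momentum constraint functions at `Φ y` are stationary at `s = 0`, then the
variations at `s = 0` of the coordinate readings of the pulled-back family `s ↦ Φ^*(F(s e₀))`
(a smooth family on `U`, `IsSmoothDataFamily.comap`; its constraint functions at `y` are those of
`F` at `Φ y` by naturality, `hamiltonianConstraintFn_comap`, `momentumConstraintFn_comap_apply`)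
lie in the kernel of the coordinate linearised constraint map at `y`:
`DH(∂_s h, ∂_s k)(y) = 0` and `DM(∂_s h, ∂_s k)(y) = 0`. [cite: BartnikIsenberg2004, §2] -/
theorem linConstraint_comapTangent_eq_zero (F : EuclideanSpace ℝ (Fin 1) → InitialDataSet (𝓡 3) X)
    (hF : IsSmoothDataFamily 1 F) {Φ : U → X} (hΦ : ContMDiff 𝓘(ℝ, E3) (𝓡 3) (∞ + 1) Φ)
    (hΦ' : ∀ u, Function.Injective (mfderiv 𝓘(ℝ, E3) (𝓡 3) Φ u)) {ι : Type*} [Fintype ι]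
    (b : Basis ι ℝ E3) (y : U)
    (hH : HasDerivAt (fun s : ℝ ↦
      haveI := (F (EuclideanSpace.single 0 s)).metric.hasLeviCivita
      (F (EuclideanSpace.single 0 s)).hamiltonianConstraintFn (Φ y)) 0 0)
    (hM : ∀ v : TangentSpace (𝓡 3) (Φ y), HasDerivAt (fun s : ℝ ↦
      haveI := (F (EuclideanSpace.single 0 s)).metric.hasLeviCivita
      (F (EuclideanSpace.single 0 s)).momentumConstraintFn (Φ y) v) 0 0) :
    MetricCoord.linHamFn b ((F 0).comap Φ hΦ hΦ').coordHOn ((F 0).comap Φ hΦ hΦ').coordKOn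
        (MetricCoord.tDeriv (fun s z ↦
          ((F (EuclideanSpace.single 0 s)).comap Φ hΦ hΦ').coordHOn z) univ 0)
        (MetricCoord.tDeriv (fun s z ↦
          ((F (EuclideanSpace.single 0 s)).comap Φ hΦ hΦ').coordKOn z) univ 0) y = 0 ∧
      ∀ Z : E3, MetricCoord.linMomFn b ((F 0).comap Φ hΦ hΦ').coordHOn
        ((F 0).comap Φ hΦ hΦ').coordKOn
        (MetricCoord.tDeriv (fun s z ↦
          ((F (EuclideanSpace.single 0 s)).comap Φ hΦ hΦ').coordHOn z) univ 0)
        (MetricCoord.tDeriv (fun s z ↦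
          ((F (EuclideanSpace.single 0 s)).comap Φ hΦ hΦ').coordKOn z) univ 0) y Z = 0 := by
  set F' : EuclideanSpace ℝ (Fin 1) → InitialDataSet 𝓘(ℝ, E3) U := fun c ↦ (F c).comap Φ hΦ hΦ'
    with hF'def
  have hF' : IsSmoothDataFamily 1 F' := hF.comap hΦ hΦ'
  have hH' : HasDerivAt (fun s : ℝ ↦
      haveI := (F' (EuclideanSpace.single 0 s)).metric.hasLeviCivita
      (F' (EuclideanSpace.single 0 s)).hamiltonianConstraintFn y) 0 0 := by
    have heq : (fun s : ℝ ↦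
        haveI := (F' (EuclideanSpace.single 0 s)).metric.hasLeviCivita
        (F' (EuclideanSpace.single 0 s)).hamiltonianConstraintFn y) =
        fun s : ℝ ↦
          haveI := (F (EuclideanSpace.single 0 s)).metric.hasLeviCivita
          (F (EuclideanSpace.single 0 s)).hamiltonianConstraintFn (Φ y) := by
      funext s
      haveI := (F (EuclideanSpace.single 0 s)).metric.hasLeviCivita
      haveI := (F' (EuclideanSpace.single 0 s)).metric.hasLeviCivita
      exact (F (EuclideanSpace.single 0 s)).hamiltonianConstraintFn_comap hΦ hΦ' rfl y
    rw [heq]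
    exact hH
  have hM' : ∀ v : E3, HasDerivAt (fun s : ℝ ↦
      haveI := (F' (EuclideanSpace.single 0 s)).metric.hasLeviCivita
      (F' (EuclideanSpace.single 0 s)).momentumConstraintFn y v) 0 0 := by
    intro v
    have heq : (fun s : ℝ ↦
        haveI := (F' (EuclideanSpace.single 0 s)).metric.hasLeviCivita
        (F' (EuclideanSpace.single 0 s)).momentumConstraintFn y v) =
        fun s : ℝ ↦
          haveI := (F (EuclideanSpace.single 0 s)).metric.hasLeviCivita
          (F (EuclideanSpace.single 0 s)).momentumConstraintFn (Φ y)
            (mfderiv 𝓘(ℝ, E3) (𝓡 3) Φ y v) := by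
      funext s
      haveI := (F (EuclideanSpace.single 0 s)).metric.hasLeviCivita
      haveI := (F' (EuclideanSpace.single 0 s)).metric.hasLeviCivita
      exact (F (EuclideanSpace.single 0 s)).momentumConstraintFn_comap_apply hΦ hΦ' rfl y
        ((F (EuclideanSpace.single 0 s)).mdifferentiableAt_traceK (Φ y)) v
    rw [heq]
    exact hM _
  exact ⟨linHamFn_lineTangent_eq_zero_chart F' hF' b y hH',
    fun Z ↦ linMomFn_lineTangent_eq_zero_chart F' hF' b y hM' Z⟩

end Manifold

end InitialDataSet

end Literature.Geometry.Lorentzian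

end
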